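import Summits.QuantumFields.BalabanUV.T4Continuum.Support.NE7K1LinStripClassSums
import Summits.QuantumFields.BalabanUV.T4Continuum.Support.NE7K1LinStripClassLine
import Literature.MathematicalPhysics.QuantumFieldTheory.Balaban1983to89.B4Torus248Decay

/-!
# NE7K1LinStripClassLineDecay — row NE7 (node U5), candidate route HOM, path H1L, cell K1-lin(s): NEEDS-ESTIMATE #E1, R-E1 TRANCHE C —
# B4 (2.35), FIRST QUANTITY, FOR THE TWO-CUTOFF LINE: the lattice kernel of the (2.48) multiplier of `(σ_s^{(n)} + aQ*Q)⁻¹Q*` decays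
# exponentially with ONE rate and ONE constant for EVERY `s ∈ [0,1]`, EVERY mesh `n ≥ 1`, EVERY `L ≥ 1`, every `a ∈ [a₋,a₊]`, every
# block offset `τ`; and ON EVERY FINITE TORUS (pv17's Poisson periodisation BY NAME) uniformly in the period vector — b04's
# `B4StripSums.kernel248_decay` ∕ `B4Torus248Decay` RE-TYPED over the class `S` and SPECIALISED to the line

Lineage `b2b-balaban-t4-ne7-p2` (CRUX PROVER NE7 #2), generation 76; file 68.  File 67: `GS n σ a τ` strip-regular on the class strip and
`kernelS_decay` for every `σ ∈ S`; file 66: `lineSymb L n s ∈ S(n; r_K(d), C_line(d), U_line(d))` for every `s ∈ [0,1]`, `n`, `L`, and the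
docking identity `lineSymb = torSymb` at the centred dual momenta.  THIS FILE ([folklore]; assembly BY NAME):

* §1 THE TORUS JOINER OVER THE CLASS (b04's `B4Torus248Decay` with `G ↦ GS`): **`torusKernelS n σ a τ N x`** — the (2.48) multiplier
  sampled at the dual-torus momenta `2π·rep(k∕N)` against the grid characters (an explicit finite sum), `= MultiPeriod.torusKernel
  (descendC (GS …) …) N x` (`rfl`), `torusKernel248 = torusKernelS (Δ^ξ_n + m²)` (`rfl`); for `σ ∈ S`, `a ∈ [a₋,a₊]`:
  **`torusKernelS_eq_periodise`** (`= Σ_m latticeKernel (GS …) (x + Nm)`, pv17's `MultiPeriod.torusKernel_descend_eq`) and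
  **`torusKernelS_decay_torusMetric`** (`≤ boundGS·periodConst κ_S d·e^{−(κ_S∕(d+1))·torusSupNorm N x}`, uniformly in `N`).
* §2 **THE LINE** (constants `κ_line(d+1, a₋, a₊)`, `M_line(d, a₋, a₊)` — functions of `(d, a₋, a₊)` ALONE): `line_GS_stripRegular`,
  **`line_kernel_decay`** `‖latticeKernel (GS n σ_s^{(n)} a τ) x‖ ≤ M_line·e^{−κ_line|x|_∞}`, **`line_torusKernel_decay_torusMetric`**,
  `line_torusKernel_decay` (centred form), `line_torusKernel_eq_periodise` — for EVERY `s ∈ [0,1]`, `n ≥ 1`, `L ≥ 1`, `a ∈ [a₋,a₊]`, `τ`,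
  period vector `N` (all `N_μ ≥ 1`) and `x ∈ ℤ^{d+1}` (PRICING-NE7 v34 §248 (d): (k1) no torus∕level dependence; (k2) every `s`).
* §3 NN SANITY: b04's `kernel248_decay` ∕ `kernel248_torusKernel_decay_torusMetric` shapes RECOVERED through the class with the explicit
  constants `κ_S(d+1, a₋, a₊, 16(d+1) + m²₊, r_NN(d+1))`, `boundGS (d+1) (cS (d+1) a₋) (16(d+1) + m²₊)`.

HONEST FRAMING: [folklore] assembly over files 62–67, b04 and pv17; statements about the MULTIPLIER's lattice ∕ torus Fourier transforms —
the operator-level identity («`torusKernelS n σ_s^{(n)} a τ` IS the kernel of `(T^𝕋(s) + aQ*Q)⁻¹Q*` on the fine torus») is NOT derived here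
(b04 does not derive it for `G_jQ_j^*` either, `B4Torus248Decay` (ii)); the `∂^ξ` ∕ Hölder halves of (2.35)∕(2.36) over S are tranche D.
This closes R-E1's FIRST QUANTITY in kernel: the two-cutoff line's (2.48) kernel decays uniformly along the line.  Nothing of Bałaban's
asserted; no `sorry`.  Census only; NE7 NOT PRINTED ∕ NOT PROVED; spine 0∕9; FIXED FINITE T⁴, rung (B)+1; NOT infinite volume, NOT mass gap,
NOT Clay.  HONEST DEPENDENCY: continuum YM on T⁴ ⇐ BetaPertH ∧ nine spine estimates (0/9 proved); BetaPertH ⇐ (D1) ∧ (D4) ∧ CAP+tail;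
G-an2-4 gates asym, D1 and NE2/3/4.
-/

noncomputable section

open Finset Complex Set UnitAddTorus

namespace Summit.QuantumFields.BalabanUV.T4Continuum.NE7K1LinStripClassLineDecay

open Literature.MathematicalPhysics.QuantumFieldTheory.Balaban1983to89
open Literature.MathematicalPhysics.QuantumFieldTheory.Balaban1983to89.B4Strip
open Literature.MathematicalPhysics.QuantumFieldTheory.Balaban1983to89.B4StripCauchy
open Literature.MathematicalPhysics.QuantumFieldTheory.Balaban1983to89.B4StripSums
open Literature.MathematicalPhysics.QuantumFieldTheory.Balaban1983to89.B4ContourShift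
open Literature.MathematicalPhysics.QuantumFieldTheory.Balaban1983to89.B4TorusKernel
open Literature.MathematicalPhysics.QuantumFieldTheory.Balaban1983to89.B4Torus248Decay (torusKernel248)
open NE7K1LinStripClass NE7K1LinStripClassCauchy NE7K1LinStripClassNN NE7K1LinStripClassKL NE7K1LinStripClassLine
open NE7K1LinStripClassSums

variable {d : ℕ}

/-! ### §1 The torus joiner over the class -/

/-- THE FINITE-TORUS KERNEL OF THE (2.48) MULTIPLIER OVER THE CLASS (b04's `torusKernel248` with `G ↦ GS`): on the unit torus `Π_μ ℤ∕N_μ` of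
blocks, fine offset `τ`, block separation `x`: `(Π_μ N_μ)⁻¹ Σ_k GS(p′_k) e^{i p′_k·x}`, `p′_{k,μ} = 2π·rep(k_μ∕N_μ) ∈ (2π∕N_μ)ℤ ∩ [−π, π)`.
[folklore] -/
def torusKernelS (n : ℕ) [NeZero n] (σ : (Fin (d + 1) → ℂ) → ℂ) (a : ℝ) (τ : Fin (d + 1) → Fin n) (N : Fin (d + 1) → ℕ)
    (x : Fin (d + 1) → ℤ) : ℂ :=
  (∏ i, ((N i : ℕ) : ℂ))⁻¹ * ∑ k : (i : Fin (d + 1)) → Fin (N i),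
    GS n σ a τ (ofRealVec (fun i => 2 * Real.pi * rep (MultiPeriod.gridPt N k i))) * mFourier x (MultiPeriod.gridPt N k)

/-- the torus kernel is pv17's `MultiPeriod.torusKernel` of the descended multiplier (definitional). [folklore] -/
theorem torusKernelS_eq_torusKernel (n : ℕ) [NeZero n] (σ : (Fin (d + 1) → ℂ) → ℂ) (a : ℝ) (τ : Fin (d + 1) → Fin n)
    {κ M : ℝ} (hreg : StripRegular (d := d) (GS n σ a τ) κ M) (hκ : 0 ≤ κ) (N : Fin (d + 1) → ℕ) (x : Fin (d + 1) → ℤ) :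
    torusKernelS n σ a τ N x = MultiPeriod.torusKernel (descendC _ hreg hκ) N x := rfl

/-- b04's finite-torus kernel of `G_jQ_j^*` IS the class torus kernel at the block Laplacian. [folklore] -/
theorem torusKernel248_eq_torusKernelS (n : ℕ) [NeZero n] (a m2 : ℝ) (τ : Fin (d + 1) → Fin n) (N : Fin (d + 1) → ℕ)
    (x : Fin (d + 1) → ℤ) : torusKernel248 n a m2 τ N x = torusKernelS n (DeltaXi n m2) a τ N x := rfl

/-- periodicity of the torus kernel in the block separation. [folklore] -/
theorem torusKernelS_translate (n : ℕ) [NeZero n] (σ : (Fin (d + 1) → ℂ) → ℂ) (a : ℝ) (τ : Fin (d + 1) → Fin n)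
    {N : Fin (d + 1) → ℕ} (hN : ∀ i, 1 ≤ N i) (x m : Fin (d + 1) → ℤ) :
    torusKernelS n σ a τ N (MultiPeriod.translate N x m) = torusKernelS n σ a τ N x := by
  unfold torusKernelS
  congr 1
  exact Finset.sum_congr rfl fun k _ => by rw [MultiPeriod.mFourier_translate_gridPt hN x m k]

variable {n : ℕ} {σ : (Fin (d + 1) → ℂ) → ℂ} {r CS Cup : ℝ}

/-- **«RELATING G ON THE TORUS TO G ON THE WHOLE LATTICE IN THE USUAL WAY» OVER THE CLASS**: for `σ ∈ S`, `0 < a₋ ≤ a ≤ a₊`, the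
finite-torus kernel is the periodisation of the lattice kernel, `torusKernelS … N x = Σ_{m ∈ ℤ^{d+1}} latticeKernel (GS …) (x + Nm)`
(pv17's `MultiPeriod.torusKernel_descend_eq` on file 67's `GS_stripRegular`). [folklore] -/
theorem torusKernelS_eq_periodise [NeZero n] (h : SymbS n σ r CS Cup) {aminus aplus a : ℝ} (ha : 0 < aminus) (ha1 : aminus ≤ a)
    (ha2 : a ≤ aplus) (τ : Fin (d + 1) → Fin n) {N : Fin (d + 1) → ℕ} (hN : ∀ i, 1 ≤ N i) (x : Fin (d + 1) → ℤ) :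
    torusKernelS n σ a τ N x = ∑' m : Fin (d + 1) → ℤ, latticeKernel (GS n σ a τ) (MultiPeriod.translate N x m) := by
  have hreg := GS_stripRegular h ha ha1 ha2 τ
  have hκ := kappaS_pos (d + 1) ha h.cup_nonneg h.r_pos (aplus := aplus)
  rw [torusKernelS_eq_torusKernel n σ a τ hreg hκ.le N x]
  exact MultiPeriod.torusKernel_descend_eq hreg hκ hN x

/-- **UNIFORM TORUS DECAY OVER THE CLASS**: for `σ ∈ S(n; r, C_S, C_up)`, `0 < a₋ ≤ a ≤ a₊`, every `τ`, every period vector (all `N_μ ≥ 1`)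
and every `x`: `‖torusKernelS n σ a τ N x‖ ≤ boundGS·periodConst κ_S d·e^{−(κ_S∕(d+1))·torusSupNorm N x}` — constants functions of
`(d, a₋, a₊, r, C_up)`, uniform in `n`, `σ`, `τ` and the VOLUME. [folklore] -/
theorem torusKernelS_decay_torusMetric [NeZero n] (h : SymbS n σ r CS Cup) {aminus aplus a : ℝ} (ha : 0 < aminus)
    (ha1 : aminus ≤ a) (ha2 : a ≤ aplus) (τ : Fin (d + 1) → Fin n) {N : Fin (d + 1) → ℕ} (hN : ∀ i, 1 ≤ N i)
    (x : Fin (d + 1) → ℤ) :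
    ‖torusKernelS n σ a τ N x‖ ≤ boundGS (d + 1) (cS (d + 1) aminus) Cup * periodConst (kappaS (d + 1) aminus aplus Cup r) d *
      Real.exp (-(kappaS (d + 1) aminus aplus Cup r / (d + 1) * MultiPeriod.torusSupNorm N x)) := by
  have hreg := GS_stripRegular h ha ha1 ha2 τ
  have hκ := kappaS_pos (d + 1) ha h.cup_nonneg h.r_pos (aplus := aplus)
  rw [torusKernelS_eq_torusKernel n σ a τ hreg hκ.le N x]
  exact MultiPeriod.torusKernel_descend_decay_torusMetric hreg hκ hN x

/-! ### §2 The two-cutoff line -/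

/-- THE LINE'S KERNEL CONSTANT `M_line(d, a₋, a₊) = boundGS (d+1) (c_S(d+1, a₋)) (U_line(d+1))`. [folklore] -/
def Mline (d : ℕ) (aminus : ℝ) : ℝ := boundGS (d + 1) (cS (d + 1) aminus) (CupLine (d + 1))

/-- `M_line ≥ 0`. [folklore] -/
theorem Mline_nonneg (d : ℕ) {aminus : ℝ} (ha : 0 < aminus) : 0 ≤ Mline d aminus :=
  boundGS_nonneg _ (cS_pos _ ha) (CupLine_nonneg _)

/-- the line's (2.48) multiplier is strip regular on `Strip (d+1) κ_line` with bound `M_line`, for EVERY `s ∈ [0,1]`, `n`, `L`, `a ∈ [a₋,a₊]`,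
`τ`. [folklore] -/
theorem line_GS_stripRegular (L : ℕ) [NeZero L] (n : ℕ) [NeZero n] {s : ℝ} (hs0 : 0 ≤ s) (hs1 : s ≤ 1) {aminus aplus a : ℝ}
    (ha : 0 < aminus) (ha1 : aminus ≤ a) (ha2 : a ≤ aplus) (τ : Fin (d + 1) → Fin n) :
    StripRegular (d := d) (GS n (lineSymb L n s) a τ) (kappaLine (d + 1) aminus aplus) (Mline d aminus) :=
  GS_stripRegular (symbS_line L n hs0 hs1) ha ha1 ha2 τ

/-- **R-E1 TRANCHE C HEADLINE — B4 (2.35), FIRST QUANTITY, ALONG THE WHOLE TWO-CUTOFF LINE (infinite volume)**: for `0 < a₋ ≤ a ≤ a₊`,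
EVERY `s ∈ [0,1]`, EVERY mesh `n ≥ 1`, EVERY `L ≥ 1`, every block offset `τ` and every `x ∈ ℤ^{d+1}`:
`‖(2π)^{−(d+1)}∫ GS_{n,σ_s,a,τ}(p′) e^{ip′·x} dp′‖ ≤ M_line(d, a₋, a₊)·e^{−κ_line(d+1, a₋, a₊)·|x|_∞}` — the kernel of the (2.48) multiplier of
`(σ_s^{(n)} + aQ*Q)⁻¹Q*` decays with ONE rate and ONE constant, functions of `(d, a₋, a₊)` ALONE. [folklore] -/
theorem line_kernel_decay (L : ℕ) [NeZero L] (n : ℕ) [NeZero n] {s : ℝ} (hs0 : 0 ≤ s) (hs1 : s ≤ 1) {aminus aplus a : ℝ}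
    (ha : 0 < aminus) (ha1 : aminus ≤ a) (ha2 : a ≤ aplus) (τ : Fin (d + 1) → Fin n) (x : Fin (d + 1) → ℤ) :
    ‖latticeKernel (GS n (lineSymb L n s) a τ) x‖
      ≤ Mline d aminus * Real.exp (-(kappaLine (d + 1) aminus aplus * supNorm x)) :=
  kernelS_decay (symbS_line L n hs0 hs1) ha ha1 ha2 τ x

/-- Euclidean form of the line's decay (rate `κ_line∕√(d+1)` in `|x|_2`). [folklore] -/
theorem line_kernel_decay_euclid (L : ℕ) [NeZero L] (n : ℕ) [NeZero n] {s : ℝ} (hs0 : 0 ≤ s) (hs1 : s ≤ 1)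
    {aminus aplus a : ℝ} (ha : 0 < aminus) (ha1 : aminus ≤ a) (ha2 : a ≤ aplus) (τ : Fin (d + 1) → Fin n)
    (x : Fin (d + 1) → ℤ) :
    ‖latticeKernel (GS n (lineSymb L n s) a τ) x‖ ≤ Mline d aminus *
      Real.exp (-(kappaLine (d + 1) aminus aplus / Real.sqrt (d + 1) * Real.sqrt (∑ i, ((x i : ℝ)) ^ 2))) :=
  kernelS_decay_euclid (symbS_line L n hs0 hs1) ha ha1 ha2 τ x

/-- **THE LINE ON THE FINITE TORUS, UNIFORMLY IN THE VOLUME**: for EVERY `s ∈ [0,1]`, `n ≥ 1`, `L ≥ 1`, `a ∈ [a₋,a₊]`, `τ`, every period vector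
`N` (all `N_μ ≥ 1`) and every block separation `x`: `‖torusKernelS n σ_s^{(n)} a τ N x‖ ≤ M_line·periodConst κ_line d·
e^{−(κ_line∕(d+1))·torusSupNorm N x}`. [folklore] -/
theorem line_torusKernel_decay_torusMetric (L : ℕ) [NeZero L] (n : ℕ) [NeZero n] {s : ℝ} (hs0 : 0 ≤ s) (hs1 : s ≤ 1)
    {aminus aplus a : ℝ} (ha : 0 < aminus) (ha1 : aminus ≤ a) (ha2 : a ≤ aplus) (τ : Fin (d + 1) → Fin n)
    {N : Fin (d + 1) → ℕ} (hN : ∀ i, 1 ≤ N i) (x : Fin (d + 1) → ℤ) :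
    ‖torusKernelS n (lineSymb L n s) a τ N x‖ ≤ Mline d aminus * periodConst (kappaLine (d + 1) aminus aplus) d *
      Real.exp (-(kappaLine (d + 1) aminus aplus / (d + 1) * MultiPeriod.torusSupNorm N x)) :=
  torusKernelS_decay_torusMetric (symbS_line L n hs0 hs1) ha ha1 ha2 τ hN x

/-- centred form: for `2|x_μ| ≤ N_μ` the torus decay is in `|x|_∞`. [folklore] -/
theorem line_torusKernel_decay (L : ℕ) [NeZero L] (n : ℕ) [NeZero n] {s : ℝ} (hs0 : 0 ≤ s) (hs1 : s ≤ 1)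
    {aminus aplus a : ℝ} (ha : 0 < aminus) (ha1 : aminus ≤ a) (ha2 : a ≤ aplus) (τ : Fin (d + 1) → Fin n)
    {N : Fin (d + 1) → ℕ} (hN : ∀ i, 1 ≤ N i) (x : Fin (d + 1) → ℤ) (hx : ∀ i, 2 * |x i| ≤ N i) :
    ‖torusKernelS n (lineSymb L n s) a τ N x‖ ≤ Mline d aminus * periodConst (kappaLine (d + 1) aminus aplus) d *
      Real.exp (-(kappaLine (d + 1) aminus aplus / (d + 1) * supNorm x)) := by
  rw [← MultiPeriod.torusSupNorm_of_centred hN hx]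
  exact line_torusKernel_decay_torusMetric L n hs0 hs1 ha ha1 ha2 τ hN x

/-- the line's torus kernel is the periodisation of its lattice kernel. [folklore] -/
theorem line_torusKernel_eq_periodise (L : ℕ) [NeZero L] (n : ℕ) [NeZero n] {s : ℝ} (hs0 : 0 ≤ s) (hs1 : s ≤ 1)
    {aminus aplus a : ℝ} (ha : 0 < aminus) (ha1 : aminus ≤ a) (ha2 : a ≤ aplus) (τ : Fin (d + 1) → Fin n)
    {N : Fin (d + 1) → ℕ} (hN : ∀ i, 1 ≤ N i) (x : Fin (d + 1) → ℤ) :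
    torusKernelS n (lineSymb L n s) a τ N x
      = ∑' m : Fin (d + 1) → ℤ, latticeKernel (GS n (lineSymb L n s) a τ) (MultiPeriod.translate N x m) :=
  torusKernelS_eq_periodise (symbS_line L n hs0 hs1) ha ha1 ha2 τ hN x

/-- at `s = 0` the line's symbol IS b04's massless block Laplacian (run A's `Δ^ξ_n`). [folklore] -/
theorem lineSymb_zero (L : ℕ) [NeZero L] (n : ℕ) : lineSymb (d := d + 1) L n 0 = DeltaXi n 0 := by
  funext q; simp [lineSymb]

/-- at `s = 1` the line's symbol IS the scaled block-mean multiplier (run B's hard Schur complement). [folklore] -/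
theorem lineSymb_one (L : ℕ) [NeZero L] (n : ℕ) : lineSymb (d := d + 1) L n 1 = scaledKL L n := by
  funext q; simp [lineSymb]

/-- hence at `s = 0` the line's (2.48) multiplier IS b04's `G n a 0 τ` and its finite-torus kernel IS b04's `torusKernel248 n a 0 τ`
(run A's endpoint of the line is the typed engine's massless case). [folklore] -/
theorem torusKernelS_line_zero (L : ℕ) [NeZero L] (n : ℕ) [NeZero n] (a : ℝ) (τ : Fin (d + 1) → Fin n)
    (N : Fin (d + 1) → ℕ) (x : Fin (d + 1) → ℤ) :
    GS n (lineSymb (d := d + 1) L n 0) a τ = G n a 0 τ ∧ torusKernelS n (lineSymb L n 0) a τ N x = torusKernel248 n a 0 τ N x := by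
  rw [lineSymb_zero]; exact ⟨rfl, rfl⟩

/-! ### §3 NN sanity: b04's (2.35) through the class -/

/-- b04's `kernel248_decay` shape with the class constants: for `0 < a₋ ≤ a ≤ a₊`, `0 ≤ m² ≤ m²₊`, every `n`, `τ`, `x`:
`‖latticeKernel (G n a m² τ) x‖ ≤ boundGS·e^{−κ_S|x|_∞}` at `C_up = 16(d+1) + m²₊`, `r = r_NN(d+1)`. [folklore] -/
theorem kernel248_decay_viaS (n : ℕ) [NeZero n] {aminus aplus a m2 m2plus : ℝ} (ha : 0 < aminus) (ha1 : aminus ≤ a)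
    (ha2 : a ≤ aplus) (hm : 0 ≤ m2) (hmp : m2 ≤ m2plus) (τ : Fin (d + 1) → Fin n) (x : Fin (d + 1) → ℤ) :
    ‖latticeKernel (G n a m2 τ) x‖ ≤ boundGS (d + 1) (cS (d + 1) aminus) (16 * (d + 1 : ℕ) + m2plus) *
      Real.exp (-(kappaS (d + 1) aminus aplus (16 * (d + 1 : ℕ) + m2plus) (rNN (d + 1)) * supNorm x)) := by
  have hS : SymbS n (DeltaXi (d := d + 1) n m2) (rNN (d + 1)) (25 / 16) (16 * (d + 1 : ℕ) + m2plus) :=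
    symbS_of_le (symbS_DeltaXi n m2 hm (rNN_pos _) (rNN_le _) (rNN_small _)) le_rfl (by linarith)
      (by linarith [rNN_small (d + 1)])
  have e : latticeKernel (G n a m2 τ) x = latticeKernel (GS n (DeltaXi n m2) a τ) x := rfl
  rw [e]
  exact kernelS_decay hS ha ha1 ha2 τ x

/-- b04's `kernel248_torusKernel_decay_torusMetric` shape with the class constants. [folklore] -/
theorem kernel248_torusKernel_decay_viaS (n : ℕ) [NeZero n] {aminus aplus a m2 m2plus : ℝ} (ha : 0 < aminus)
    (ha1 : aminus ≤ a) (ha2 : a ≤ aplus) (hm : 0 ≤ m2) (hmp : m2 ≤ m2plus) (τ : Fin (d + 1) → Fin n)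
    {N : Fin (d + 1) → ℕ} (hN : ∀ i, 1 ≤ N i) (x : Fin (d + 1) → ℤ) :
    ‖torusKernel248 n a m2 τ N x‖ ≤ boundGS (d + 1) (cS (d + 1) aminus) (16 * (d + 1 : ℕ) + m2plus) *
      periodConst (kappaS (d + 1) aminus aplus (16 * (d + 1 : ℕ) + m2plus) (rNN (d + 1))) d *
      Real.exp (-(kappaS (d + 1) aminus aplus (16 * (d + 1 : ℕ) + m2plus) (rNN (d + 1)) / (d + 1) *
        MultiPeriod.torusSupNorm N x)) := by
  have hS : SymbS n (DeltaXi (d := d + 1) n m2) (rNN (d + 1)) (25 / 16) (16 * (d + 1 : ℕ) + m2plus) :=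
    symbS_of_le (symbS_DeltaXi n m2 hm (rNN_pos _) (rNN_le _) (rNN_small _)) le_rfl (by linarith)
      (by linarith [rNN_small (d + 1)])
  rw [torusKernel248_eq_torusKernelS]
  exact torusKernelS_decay_torusMetric hS ha ha1 ha2 τ hN x

end Summit.QuantumFields.BalabanUV.T4Continuum.NE7K1LinStripClassLineDecay

end
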